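import Summits.QuantumFields.YangMills.Theorems.ColdStartUniversalityShenZhuZhuLoopFamiliesSU2
import Summits.QuantumFields.YangMills.Theorems.ColdStartUniversalityShenZhuZhuTorusRectangleSU2
import HarnessLib

/-!
# SELF-AVERAGING OF THE PLAQUETTE DENSITY: for any finite set `𝒫` of `n` plaquettes of `ℤ³`, the average `A = n⁻¹ Σ_{p∈𝒫} W_p` has Gaussian
# fluctuations `O(n^{-1/2})` under every infinite-volume limit point of three-dimensional `SU(2)` lattice Yang–Mills at strong coupling:
# `μ{|A − ⟨A⟩| ≥ r} ≤ 2 exp(−(1 − 24|β|) n r²/64)`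

Seat `ym-line-csu-p1` (g38), route `ColdStartUniversality` of `Summits/QuantumFields/YangMills`, helper file G17 — the explicit instance of the
loop-family theorem G12 (`szz_loopFamily_twoSided_su2`) for averages of unit plaquettes `W_p = ½ Re tr hol_{∂p}` (`rectWalk x i j 1 1`, plane
`i < j`), with the lattice combinatorics made explicit:

* `mem_walkEdges_unitSquare` — the links of the unit plaquette at `x` in the plane `(i, j)` are `(x,i), (x+eⱼ,i), (x,j), (x+eᵢ,j)`;
  `dartMult_unitSquare_le_one` — each with multiplicity `≤ 1` (`i ≠ j`).
* `card_filter_unitSquare_mem_le_four` (`d = 3`) — a link of `ℤ³` lies on at most `4` plaquettes of any set of plaquettes (planes through its direction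
  `×` position of the base point).
* `sum_sq_avgMult_le` — hence `Σ_{e ∈ ⋃ links} (Σ_{p∈𝒫} n⁻¹ mult_p(e))² ≤ 64/n`.
* ★★★ `szz_plaquetteDensity_twoSided_su2` — for EVERY infinite-volume limit point `μ` of `SU(2)` lattice Yang–Mills on `ℤ³` at 't Hooft coupling
  `|β| < 1/24`, every finite set `𝒫` of `n ≥ 1` plaquettes and every `r ≥ 0`:
  `μ{|n⁻¹ Σ_{p∈𝒫} W_p − ⟨n⁻¹ Σ_{p∈𝒫} W_p⟩_μ| ≥ r} ≤ 2 exp(−(1 − 24|β|) n r²/64)` — the empirical plaquette (action) density of ANY region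
  concentrates at rate `√n`, uniformly over regions and limit points (no translation invariance, no clustering used).

THEOREMS ONLY, no definition, no sorry.  HONEST FRAMING: STRONG coupling, fixed lattice, `SU(2)`, `d = 3`; nothing at weak coupling / in the
continuum, nothing `K`-uniform along the route's scaling (`UniformColdStartMixing`, 24809, ASIDE, not restated); no crux, rung or summit statement is
proved; the Yang–Mills mass gap is NOT proved.

References: H. Shen, R. Zhu, X. Zhu, CMP 400 (2023) 805–851 = arXiv:2204.12737, Thm 1.4, Cor. 4.8 [ShenZhuZhu2022]; M. Ledoux (2001) §5.1.
-/

set_option autoImplicit false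

noncomputable section

namespace Summit.QuantumFields.YangMills.Theorems.ColdStartUniversality

open MeasureTheory ProbabilityTheory Finset Filter Set Function
open scoped BigOperators NNReal ENNReal Topology Matrix Matrix.Norms.Frobenius ContDiff
open SimpleGraph
open Literature.Probability.LatticeModels (Site zdGraph)
open Literature.Probability.Process Literature.MathematicalPhysics.QuantumFieldTheory
open Literature.MathematicalPhysics.QuantumLattice (fundamentalRep fundamentalLatticeRep continuous_fundamentalRep fundamentalRep_apply
  infiniteVolumeLimitPoints LGConfig normalisedCharacter dartStep dartStep_symm dartStep_add_single wilsonLoopObs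
  torusEdge torusLift lineWalk rectWalk length_rectWalk)
open Summit.Ventures.YMGap.RobustBall (dartMult sum_walkEdges_dartMult dartMult_eq_zero_of_not_mem one_le_dartMult_of_mem)

/-! ## §1. The four links of a unit plaquette -/

/-- **The links of the unit plaquette** at `x` in the plane `(i, j)`: every link of `rectWalk x i j 1 1` is one of `(x,i)`, `(x+eⱼ,i)`, `(x,j)`,
`(x+eᵢ,j)`. [folklore] -/
theorem mem_walkEdges_unitSquare {d : ℕ} {x : Site d} {i j : Fin d} {e : Literature.MathematicalPhysics.QuantumLattice.ZdEdge d}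
    (he : e ∈ walkEdges (rectWalk x i j 1 1)) :
    (e = (x, i) ∨ e = (x + Pi.single j 1, i)) ∨ (e = (x, j) ∨ e = (x + Pi.single i 1, j)) := by
  classical
  -- the single oriented edge of a one-step walk
  have hone : ∀ (k : Fin d) (y : Site d), ((lineWalk k 1 y).darts.map fun a => (dartStep a).1) = [(y, k)] := by
    intro k y
    rw [lineWalk, Walk.darts_cons, Walk.darts_copy, List.map_cons, dartStep_add_single]
    simp [lineWalk]
  have hrev : ∀ {y y' : Site d} (w : (zdGraph d).Walk y y'),
      (w.reverse.darts.map fun a => (dartStep a).1) = (w.darts.map fun a => (dartStep a).1).reverse := by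
    intro y y' w
    rw [Walk.darts_reverse, List.map_reverse, List.map_map]
    congr 1
    exact List.map_congr_left fun a _ => by simp [dartStep_symm]
  unfold walkEdges at he
  rw [List.mem_toFinset, rectWalk, Walk.darts_append, Walk.darts_append, Walk.darts_append, List.map_append, List.map_append,
    List.map_append] at he
  rcases List.mem_append.1 he with hA | hBCD
  · rw [hone, List.mem_singleton] at hA
    exact Or.inl (Or.inl hA)
  rcases List.mem_append.1 hBCD with hB | hCD
  · rw [Walk.darts_copy, hone, List.mem_singleton] at hB
    refine Or.inr (Or.inr ?_)
    rw [hB]; simp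
  rcases List.mem_append.1 hCD with hC | hD
  · rw [hrev, List.mem_reverse, hone, List.mem_singleton] at hC
    refine Or.inl (Or.inr ?_)
    rw [hC]; simp
  · rw [hrev, List.mem_reverse, hone, List.mem_singleton] at hD
    exact Or.inr (Or.inl hD)

/-- **Each link of a unit plaquette has multiplicity at most one** (`i ≠ j`): from `Σ_e mult(e)² = 4 = Σ_e mult(e)`. [folklore] -/
theorem dartMult_unitSquare_le_one {d : ℕ} (x : Site d) {i j : Fin d} (hij : i ≠ j)
    (e : Literature.MathematicalPhysics.QuantumLattice.ZdEdge d) : dartMult (rectWalk x i j 1 1) e ≤ 1 := by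
  classical
  by_cases he : e ∈ walkEdges (rectWalk x i j 1 1)
  · -- `Σ (mult² - mult) = 0` with nonnegative terms
    have hsq : ∑ e' ∈ walkEdges (rectWalk x i j 1 1), dartMult (rectWalk x i j 1 1) e' ^ 2 = 4 := by
      have h := sum_dartMult_sq_rectWalk x hij (le_refl 1) (le_refl 1)
      have h' : ((∑ e' ∈ walkEdges (rectWalk x i j 1 1), dartMult (rectWalk x i j 1 1) e' ^ 2 : ℕ) : ℝ) = 4 := by
        push_cast; rw [h]; norm_num
      exact_mod_cast h'
    have hlin : ∑ e' ∈ walkEdges (rectWalk x i j 1 1), dartMult (rectWalk x i j 1 1) e' = 4 := by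
      rw [sum_walkEdges_dartMult, length_rectWalk]
    have hdiff : ∑ e' ∈ walkEdges (rectWalk x i j 1 1),
        (dartMult (rectWalk x i j 1 1) e' ^ 2 - dartMult (rectWalk x i j 1 1) e') = 0 := by
      have hle : ∀ e' ∈ walkEdges (rectWalk x i j 1 1), dartMult (rectWalk x i j 1 1) e' ≤ dartMult (rectWalk x i j 1 1) e' ^ 2 :=
        fun e' _ => by rw [sq]; exact Nat.le_mul_self _
      rw [Finset.sum_tsub_distrib _ hle, hsq, hlin]
    have hterm := (Finset.sum_eq_zero_iff.1 hdiff) e he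
    -- `m² - m = 0` in `ℕ` forces `m ≤ 1`
    set m := dartMult (rectWalk x i j 1 1) e
    refine Nat.le_of_not_lt fun hm => ?_
    have h2 : m * m - m = 0 := by rw [← sq]; exact hterm
    have h3 : 2 * m ≤ m * m := Nat.mul_le_mul_right m hm
    omega
  · rw [dartMult_eq_zero_of_not_mem _ he]; exact Nat.zero_le _

/-! ## §2. `d = 3`: a link lies on at most four plaquettes -/

/-- **Incidence bound**: a link `e` of `ℤ³` lies on at most `4` unit plaquettes `(x, (i,j))`, `i < j`, of any finite set `𝒫` (the plane must contain
the direction of `e` — `2` choices — and the base point is `e.1` or `e.1 − e_{other}` — `2` choices). [folklore] -/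
theorem card_filter_unitSquare_mem_le_four (s : Finset (Site 3 × {q : Fin 3 × Fin 3 // q.1 < q.2}))
    (e : Literature.MathematicalPhysics.QuantumLattice.ZdEdge 3) :
    (s.filter fun p => e ∈ walkEdges (rectWalk p.1 p.2.1.1 p.2.1.2 1 1)).card ≤ 4 := by
  classical
  -- target: (planes containing the direction of `e`) × (is the base point `e.1`?)
  set T : Finset ({q : Fin 3 × Fin 3 // q.1 < q.2} × Bool) :=
    (Finset.univ.filter fun q : {q : Fin 3 × Fin 3 // q.1 < q.2} => q.1.1 = e.2 ∨ q.1.2 = e.2) ×ˢ Finset.univ with hT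
  have hTcard : T.card ≤ 4 := by
    have hplanes : ∀ k : Fin 3, (Finset.univ.filter fun q : {q : Fin 3 × Fin 3 // q.1 < q.2} => q.1.1 = k ∨ q.1.2 = k).card = 2 := by
      decide
    rw [hT, Finset.card_product, hplanes, Finset.card_univ, Fintype.card_bool]
  set f : Site 3 × {q : Fin 3 × Fin 3 // q.1 < q.2} → {q : Fin 3 × Fin 3 // q.1 < q.2} × Bool :=
    fun p => (p.2, decide (p.1 = e.1)) with hf
  refine le_trans (Finset.card_le_card_of_injOn f (fun p hp => ?_) ?_) hTcard
  · -- maps to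
    rw [Finset.mem_coe, Finset.mem_filter] at hp
    rw [hT, Finset.mem_coe, Finset.mem_product]
    refine ⟨Finset.mem_filter.2 ⟨Finset.mem_univ _, ?_⟩, Finset.mem_univ _⟩
    rcases mem_walkEdges_unitSquare hp.2 with (h | h) | (h | h)
    · exact Or.inl (by rw [h])
    · exact Or.inl (by rw [h])
    · exact Or.inr (by rw [h])
    · exact Or.inr (by rw [h])
  · -- injective
    intro p hp p' hp' hfp
    rw [Finset.mem_coe, Finset.mem_filter] at hp hp'
    obtain ⟨x, q⟩ := p
    obtain ⟨x', q'⟩ := p'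
    simp only [hf, Prod.mk.injEq, decide_eq_decide] at hfp
    obtain ⟨hq, hb⟩ := hfp
    subst hq
    obtain ⟨⟨i, j⟩, hij⟩ := q
    simp only at hp hp' hb ⊢
    have hne : i ≠ j := ne_of_lt hij
    suffices hx : x = x' by rw [hx]
    by_cases hxe : x = e.1
    · exact hxe.trans (hb.1 hxe).symm
    · have hxe' : ¬ x' = e.1 := fun h => hxe (hb.2 h)
      rcases mem_walkEdges_unitSquare hp.2 with (h | h) | (h | h)
      · exact absurd (by rw [h]) hxe
      · rcases mem_walkEdges_unitSquare hp'.2 with (h' | h') | (h' | h')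
        · exact absurd (by rw [h']) hxe'
        · exact add_right_cancel (Prod.mk_inj.1 (h.symm.trans h')).1
        · exact absurd (by rw [h']) hxe'
        · exact absurd (Prod.mk_inj.1 (h.symm.trans h')).2 hne
      · exact absurd (by rw [h]) hxe
      · rcases mem_walkEdges_unitSquare hp'.2 with (h' | h') | (h' | h')
        · exact absurd (by rw [h']) hxe'
        · exact absurd (Prod.mk_inj.1 (h.symm.trans h')).2 hne.symm
        · exact absurd (by rw [h']) hxe'
        · exact add_right_cancel (Prod.mk_inj.1 (h.symm.trans h')).1

/-! ## §3. The denominator of the loop-family bound for a plaquette average is `≤ 64/n` -/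

/-- **`Σ_{e ∈ ⋃ links} (Σ_{p∈𝒫} n⁻¹ mult_p(e))² ≤ 64/n`** for a set `𝒫` of `n ≥ 1` unit plaquettes of `ℤ³` (inner sum `≤ 4/n` by the incidence bound and
`mult ≤ 1`; at most `4n` links). [folklore] -/
theorem sum_sq_avgMult_le (s : Finset (Site 3 × {q : Fin 3 × Fin 3 // q.1 < q.2})) (hs : s.Nonempty) :
    ∑ e ∈ s.biUnion (fun p => walkEdges (rectWalk p.1 p.2.1.1 p.2.1.2 1 1)),
        (∑ p ∈ s, |((s.card : ℝ))⁻¹| * (dartMult (rectWalk p.1 p.2.1.1 p.2.1.2 1 1) e : ℝ)) ^ 2 ≤ 64 / s.card := by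
  classical
  have hn : 0 < (s.card : ℝ) := by exact_mod_cast hs.card_pos
  have habs : |((s.card : ℝ))⁻¹| = ((s.card : ℝ))⁻¹ := abs_of_pos (inv_pos.2 hn)
  -- inner sums
  have hinner : ∀ e : Literature.MathematicalPhysics.QuantumLattice.ZdEdge 3,
      ∑ p ∈ s, |((s.card : ℝ))⁻¹| * (dartMult (rectWalk p.1 p.2.1.1 p.2.1.2 1 1) e : ℝ) ≤ 4 / s.card := by
    intro e
    rw [← Finset.mul_sum, habs]
    have hnat : ∑ p ∈ s, dartMult (rectWalk p.1 p.2.1.1 p.2.1.2 1 1) e ≤ 4 := by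
      calc ∑ p ∈ s, dartMult (rectWalk p.1 p.2.1.1 p.2.1.2 1 1) e
          = ∑ p ∈ s.filter (fun p => e ∈ walkEdges (rectWalk p.1 p.2.1.1 p.2.1.2 1 1)),
              dartMult (rectWalk p.1 p.2.1.1 p.2.1.2 1 1) e := by
            rw [Finset.sum_filter]
            refine Finset.sum_congr rfl fun p _ => ?_
            split_ifs with h
            · rfl
            · exact dartMult_eq_zero_of_not_mem _ h
        _ ≤ ∑ p ∈ s.filter (fun p => e ∈ walkEdges (rectWalk p.1 p.2.1.1 p.2.1.2 1 1)), 1 :=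
            Finset.sum_le_sum fun p _ => dartMult_unitSquare_le_one p.1 (ne_of_lt p.2.2) e
        _ ≤ 4 := by
            rw [Finset.sum_const, smul_eq_mul, mul_one]
            exact card_filter_unitSquare_mem_le_four s e
    have hreal : (∑ p ∈ s, (dartMult (rectWalk p.1 p.2.1.1 p.2.1.2 1 1) e : ℝ)) ≤ 4 := by exact_mod_cast hnat
    rw [div_eq_inv_mul]
    exact mul_le_mul_of_nonneg_left hreal (inv_nonneg.2 hn.le)
  have hinner0 : ∀ e : Literature.MathematicalPhysics.QuantumLattice.ZdEdge 3,
      0 ≤ ∑ p ∈ s, |((s.card : ℝ))⁻¹| * (dartMult (rectWalk p.1 p.2.1.1 p.2.1.2 1 1) e : ℝ) :=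
    fun e => Finset.sum_nonneg fun p _ => mul_nonneg (abs_nonneg _) (Nat.cast_nonneg _)
  -- number of links
  have hΛ : ((s.biUnion (fun p => walkEdges (rectWalk p.1 p.2.1.1 p.2.1.2 1 1))).card : ℝ) ≤ 4 * s.card := by
    have hnat : (s.biUnion (fun p => walkEdges (rectWalk p.1 p.2.1.1 p.2.1.2 1 1))).card ≤ s.card * 4 := by
      refine Finset.card_biUnion_le.trans ?_
      calc ∑ p ∈ s, (walkEdges (rectWalk p.1 p.2.1.1 p.2.1.2 1 1)).card ≤ ∑ p ∈ s, 4 :=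
            Finset.sum_le_sum fun p _ => (card_walkEdges_le_length _).trans (by rw [length_rectWalk])
        _ = s.card * 4 := by rw [Finset.sum_const, smul_eq_mul]
    have h' : ((s.biUnion (fun p => walkEdges (rectWalk p.1 p.2.1.1 p.2.1.2 1 1))).card : ℝ) ≤ ((s.card * 4 : ℕ) : ℝ) := by
      exact_mod_cast hnat
    refine h'.trans (le_of_eq ?_)
    push_cast; ring
  calc ∑ e ∈ s.biUnion (fun p => walkEdges (rectWalk p.1 p.2.1.1 p.2.1.2 1 1)),
        (∑ p ∈ s, |((s.card : ℝ))⁻¹| * (dartMult (rectWalk p.1 p.2.1.1 p.2.1.2 1 1) e : ℝ)) ^ 2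
      ≤ ∑ e ∈ s.biUnion (fun p => walkEdges (rectWalk p.1 p.2.1.1 p.2.1.2 1 1)), (4 / (s.card : ℝ)) ^ 2 :=
        Finset.sum_le_sum fun e _ => pow_le_pow_left₀ (hinner0 e) (hinner e) 2
    _ = ((s.biUnion (fun p => walkEdges (rectWalk p.1 p.2.1.1 p.2.1.2 1 1))).card : ℝ) * (4 / (s.card : ℝ)) ^ 2 := by
        rw [Finset.sum_const, nsmul_eq_mul]
    _ ≤ 4 * (s.card : ℝ) * (4 / (s.card : ℝ)) ^ 2 := mul_le_mul_of_nonneg_right hΛ (sq_nonneg _)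
    _ = 64 / s.card := by
        field_simp
        ring

/-- **Positivity of the denominator**: `0 < Σ_e (Σ_p n⁻¹ mult_p(e))²` for a non-empty set of plaquettes (`i ≠ j`). [folklore] -/
theorem sum_sq_avgMult_pos (s : Finset (Site 3 × {q : Fin 3 × Fin 3 // q.1 < q.2})) (hs : s.Nonempty) :
    0 < ∑ e ∈ s.biUnion (fun p => walkEdges (rectWalk p.1 p.2.1.1 p.2.1.2 1 1)),
        (∑ p ∈ s, |((s.card : ℝ))⁻¹| * (dartMult (rectWalk p.1 p.2.1.1 p.2.1.2 1 1) e : ℝ)) ^ 2 := by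
  classical
  obtain ⟨p₀, hp₀⟩ := hs
  have hcard : 0 < s.card := Finset.card_pos.2 ⟨p₀, hp₀⟩
  have hn : 0 < (s.card : ℝ) := by exact_mod_cast hcard
  -- a link of `p₀`
  have hsum : ∑ e ∈ walkEdges (rectWalk p₀.1 p₀.2.1.1 p₀.2.1.2 1 1), dartMult (rectWalk p₀.1 p₀.2.1.1 p₀.2.1.2 1 1) e ≠ 0 := by
    rw [sum_walkEdges_dartMult, length_rectWalk]; norm_num
  obtain ⟨e₀, he₀⟩ := Finset.nonempty_of_sum_ne_zero hsum
  have hmult : 1 ≤ dartMult (rectWalk p₀.1 p₀.2.1.1 p₀.2.1.2 1 1) e₀ := one_le_dartMult_of_mem _ he₀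
  have he₀Λ : e₀ ∈ s.biUnion (fun p => walkEdges (rectWalk p.1 p.2.1.1 p.2.1.2 1 1)) :=
    Finset.mem_biUnion.2 ⟨p₀, hp₀, he₀⟩
  set F : Site 3 × {q : Fin 3 × Fin 3 // q.1 < q.2} → ℝ := fun p =>
    |((s.card : ℝ))⁻¹| * (dartMult (rectWalk p.1 p.2.1.1 p.2.1.2 1 1) e₀ : ℝ) with hF
  set Gf : Literature.MathematicalPhysics.QuantumLattice.ZdEdge 3 → ℝ := fun e =>
    (∑ p ∈ s, |((s.card : ℝ))⁻¹| * (dartMult (rectWalk p.1 p.2.1.1 p.2.1.2 1 1) e : ℝ)) ^ 2 with hGf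
  have hF0 : ∀ p ∈ s, 0 ≤ F p := fun p _ => mul_nonneg (abs_nonneg _) (Nat.cast_nonneg _)
  have hG0 : ∀ e ∈ s.biUnion (fun p => walkEdges (rectWalk p.1 p.2.1.1 p.2.1.2 1 1)), 0 ≤ Gf e := fun e _ => sq_nonneg _
  have h1 : ((s.card : ℝ))⁻¹ ≤ F p₀ := by
    have hm : (1 : ℝ) ≤ (dartMult (rectWalk p₀.1 p₀.2.1.1 p₀.2.1.2 1 1) e₀ : ℝ) := by exact_mod_cast hmult
    rw [hF]
    simp only
    rw [abs_of_pos (inv_pos.2 hn)]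
    exact le_mul_of_one_le_right (inv_nonneg.2 hn.le) hm
  have h2 : F p₀ ≤ ∑ p ∈ s, F p := Finset.single_le_sum hF0 hp₀
  have h3 : ((s.card : ℝ))⁻¹ ^ 2 ≤ Gf e₀ := by
    rw [hGf]
    exact pow_le_pow_left₀ (inv_nonneg.2 hn.le) (h1.trans h2) 2
  have h4 : Gf e₀ ≤ ∑ e ∈ s.biUnion (fun p => walkEdges (rectWalk p.1 p.2.1.1 p.2.1.2 1 1)), Gf e := Finset.single_le_sum hG0 he₀Λ
  have h0 : (0 : ℝ) < ((s.card : ℝ))⁻¹ ^ 2 := pow_pos (inv_pos.2 hn) 2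
  exact lt_of_lt_of_le h0 (h3.trans h4)

/-! ## §4. Self-averaging of the plaquette density -/

/-- ★★★ **Self-averaging of the plaquette density under every infinite-volume limit point** of `SU(2)` lattice Yang–Mills on `ℤ³` at 't Hooft
coupling `|β| < 1/24`: for every finite set `𝒫` of `n ≥ 1` unit plaquettes (any shape, any region) and every `r ≥ 0`, the average
`A = n⁻¹ Σ_{p∈𝒫} W_p` (`W_p = ½ Re tr hol_{∂p}`) satisfies `μ{|A − ⟨A⟩_μ| ≥ r} ≤ 2 exp(−(1 − 24|β|) n r²/64)` — Gaussian fluctuations of size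
`O(n^{-1/2})`, uniformly over regions and limit points.  Strong coupling, fixed lattice; the Yang–Mills mass gap is NOT proved.
[cite: ShenZhuZhu2022, Theorem 1.4, Corollary 4.8] -/
theorem szz_plaquetteDensity_twoSided_su2 {β : ℝ} (hβ : |β| < 1 / 24)
    {μ : Measure (LGConfig 3 (Matrix.specialUnitaryGroup (Fin 2) ℂ))}
    (hμ : μ ∈ infiniteVolumeLimitPoints (d := 3) (fundamentalRep (Fin 2)) (((2 : ℕ) : ℝ) * β))
    (s : Finset (Site 3 × {q : Fin 3 × Fin 3 // q.1 < q.2})) (hs : s.Nonempty) {r : ℝ} (hr : 0 ≤ r) :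
    μ.real {U | r ≤ |(∑ p ∈ s, ((s.card : ℝ))⁻¹ *
        wilsonLoopObs (fun g : Matrix.specialUnitaryGroup (Fin 2) ℂ => normalisedCharacter 2 (fundamentalRep (Fin 2) g))
          (rectWalk p.1 p.2.1.1 p.2.1.2 1 1) U) -
        ∫ V, ∑ p ∈ s, ((s.card : ℝ))⁻¹ *
          wilsonLoopObs (fun g : Matrix.specialUnitaryGroup (Fin 2) ℂ => normalisedCharacter 2 (fundamentalRep (Fin 2) g))
            (rectWalk p.1 p.2.1.1 p.2.1.2 1 1) V ∂μ|} ≤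
      2 * Real.exp (-((1 - 24 * |β|) * s.card * r ^ 2 / 64)) := by
  have hK : 0 < 1 - 24 * |β| := by linarith
  have hn : 0 < (s.card : ℝ) := by exact_mod_cast hs.card_pos
  have hD := sum_sq_avgMult_pos s hs
  have hDle := sum_sq_avgMult_le s hs
  have h := szz_loopFamily_twoSided_su2 hβ hμ s (x := fun p => p.1) (fun p => rectWalk p.1 p.2.1.1 p.2.1.2 1 1)
    (fun _ => ((s.card : ℝ))⁻¹) hD hr
  refine h.trans (mul_le_mul_of_nonneg_left (Real.exp_le_exp.2 ?_) (by norm_num))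
  rw [neg_le_neg_iff]
  calc (1 - 24 * |β|) * s.card * r ^ 2 / 64 = (1 - 24 * |β|) * r ^ 2 / (64 / s.card) := by
        field_simp
    _ ≤ (1 - 24 * |β|) * r ^ 2 / ∑ e ∈ s.biUnion (fun p => walkEdges (rectWalk p.1 p.2.1.1 p.2.1.2 1 1)),
          (∑ p ∈ s, |((s.card : ℝ))⁻¹| * (dartMult (rectWalk p.1 p.2.1.1 p.2.1.2 1 1) e : ℝ)) ^ 2 :=
        div_le_div_of_nonneg_left (by positivity) hD hDle

/-- ★★★ **Self-averaging of the plaquette density on every torus, uniformly in the volume, `|β'| < 1/12`**: for the periodic `SU(2)` Wilson measure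
on `(ℤ/L)³`, every finite set `𝒫` of `n ≥ 1` unit plaquettes of `ℤ³` whose links stay distinct on the torus, read through the periodic lift, and
every `r ≥ 0`: `μ_{L,β'}{|A − ⟨A⟩| ≥ r} ≤ 2 exp(−(1 − 12|β'|) n r²/64)`, `A = n⁻¹ Σ_{p∈𝒫} W_p`.  Strong coupling, fixed lattice; the Yang–Mills mass
gap is NOT proved. [cite: ShenZhuZhu2022, Corollary 4.4 (4.11), Corollary 4.8] -/
theorem torus_plaquetteDensity_twoSided_su2_uniform {β' : ℝ} (hβ : |β'| < 1 / 12) (L : ℕ) [NeZero L]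
    (s : Finset (Site 3 × {q : Fin 3 × Fin 3 // q.1 < q.2})) (hs : s.Nonempty)
    (hinj : Set.InjOn (torusEdge (d := 3) L) ↑(s.biUnion (fun p => walkEdges (rectWalk p.1 p.2.1.1 p.2.1.2 1 1))))
    {r : ℝ} (hr : 0 ≤ r) :
    ((wilsonMeasure (d := 3) (L := L) (fundamentalRep (Fin 2)) β')).real {V | r ≤ |(∑ p ∈ s, ((s.card : ℝ))⁻¹ *
        wilsonLoopObs (fun g : Matrix.specialUnitaryGroup (Fin 2) ℂ => normalisedCharacter 2 (fundamentalRep (Fin 2) g))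
          (rectWalk p.1 p.2.1.1 p.2.1.2 1 1) (torusLift L V)) -
        ∫ V', ∑ p ∈ s, ((s.card : ℝ))⁻¹ *
          wilsonLoopObs (fun g : Matrix.specialUnitaryGroup (Fin 2) ℂ => normalisedCharacter 2 (fundamentalRep (Fin 2) g))
            (rectWalk p.1 p.2.1.1 p.2.1.2 1 1) (torusLift L V') ∂(wilsonMeasure (d := 3) (L := L) (fundamentalRep (Fin 2)) β')|} ≤
      2 * Real.exp (-((1 - 12 * |β'|) * s.card * r ^ 2 / 64)) := by
  have hK : 0 < 1 - 12 * |β'| := by linarith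
  have hn : 0 < (s.card : ℝ) := by exact_mod_cast hs.card_pos
  have hD := sum_sq_avgMult_pos s hs
  have hDle := sum_sq_avgMult_le s hs
  have h := torus_loopFamily_twoSided_su2_uniform hβ L s (x := fun p => p.1) (fun p => rectWalk p.1 p.2.1.1 p.2.1.2 1 1)
    (fun _ => ((s.card : ℝ))⁻¹) hinj hD hr
  refine h.trans (mul_le_mul_of_nonneg_left (Real.exp_le_exp.2 ?_) (by norm_num))
  rw [neg_le_neg_iff]
  calc (1 - 12 * |β'|) * s.card * r ^ 2 / 64 = (1 - 12 * |β'|) * r ^ 2 / (64 / s.card) := by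
        field_simp
    _ ≤ (1 - 12 * |β'|) * r ^ 2 / ∑ e ∈ s.biUnion (fun p => walkEdges (rectWalk p.1 p.2.1.1 p.2.1.2 1 1)),
          (∑ p ∈ s, |((s.card : ℝ))⁻¹| * (dartMult (rectWalk p.1 p.2.1.1 p.2.1.2 1 1) e : ℝ)) ^ 2 :=
        div_le_div_of_nonneg_left (by positivity) hD hDle

end Summit.QuantumFields.YangMills.Theorems.ColdStartUniversality

end
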